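import Summits.QuantumFields.BalabanUV.T4Continuum.Support.VectorLineTransport

/-!
# T⁴ programme, spine node NE2 (U1a), lane P2 — SUPPLIER LEAF V-COMP-L: COMPOSITION CLOSES IN THE LINE-INDEXED CLASS — the one-step line-indexed average over
# the `n`-blocks of a one-step line-indexed average IS the `n·L` line-indexed average with the COMPOSITE transports, `Q_T ∘ Q_{T′} = Q_{T ⊛ T′}` (through `sites`)

NE2 formalisation swarm `b2b-balaban-t4-ne2-formalise-*`, leaf 03 GEN 4 (`prover-b2b-balaban-t4-ne2-formalise-leaf-03-g4-0`); the retired road owner t4-ne2-p2-g11's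
hand-over (journal 2026-08-20 ≈11:06Z, (3) «V-COMP for `QvL` towers») and RULING (≈11:01Z (a) «`QvL` … closed under composition … THE carriers of the TOWER
(V-COMP, V-END); `QvT` the one-step special case»); journal INTENT ≈11:14Z.  On top of `Support/VectorLineTransport` (`QvL`) and the tree's (1.16)–(1.18)
certificate `B5Composition116.{J, JEquiv, sum_J, sum_T, bpt_bpt_tstep, sites}` ([Balaban1984PropagatorsI] (1.16)–(1.18) p.20); the 1-form analogue of leaf-02-g3's
scalar `VariationalCovariantTower.Qk_comp_Q1_apply`.
 * §1 **`compL T T′ y J U μ := T y j₂ t₂ μ ∘ T′ (n·y + j₂ + t₂e_μ) j₁ t₁ μ`** with `(j₂, j₁) := JEquiv⁻¹ J` (outer∕inner offsets, `J = j₁ + L·j₂`) and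
   `(t₂, t₁) := finProdFinEquiv⁻¹ U` (outer∕inner positions, `U = t₁ + L·t₂`) — the bond at position `U` of the long line started at `(nL)·y + J` is position `t₁` of
   the INNER line started at the fine base point `j₁` of the `n`-lattice site `n·y + j₂ + t₂e_μ`, itself position `t₂` of the OUTER line started at `n·y + j₂`
   ([Balaban1985BackgroundPropagators] (3.15) «compositions of one-step averaging operators», SHAPE); `compL_J` (the composite at split indices), `norm_compL_le`
   (contractive factors ⟹ contractive composite);
 * §2 `val_finProdFinEquiv` and **`QvL_comp : QvL n M T (QvL L (fine n M) T′ W′) = QvL (n·L) M (compL T T′) (fun x μ ↦ W′ (sites n L M x) μ)`**.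
So the k-step averaging of record is again a `QvL` (start ↦ start, position `t₁ + L·t₂`); the BOND-indexed class `QvT` is NOT closed under this composition (the
composite transport of a fine bond depends on the inner line it sits in) — located note N-ne2leaf03g4-1 (iii).  NOT CLAIMED: the relative bound of composite
transports against a straight reference (geometric, (O10)-type), V-END.

HONEST FRAMING (T4-DAG p. 1).  Model level; transports DATA; [folklore] reindexing; nothing printed is a hypothesis beyond the (1.16)–(1.18) SHAPE certified in the
tree; one data `def` (`compL`), no `def … : Prop`, no `sorry`; axioms standard.  NE2 NOT proved; spine 0/9; rung (B)+1 finite T⁴ — NOT infinite volume, NOT mass gap,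
NOT Clay.  HONEST DEPENDENCY (cell, verbatim): continuum YM on T⁴ ⇐ BetaPertH ∧ nine spine estimates (0/9 proved); BetaPertH ⇐ (D1) ∧ (D4) ∧ CAP+tail; G-an2-4
gates asym, D1 and NE2/3/4.
-/

noncomputable section

namespace Summit.QuantumFields.BalabanUV.T4Continuum.VectorBlockTrialForm

open Finset
open scoped ComplexConjugate Matrix
open Literature.MathematicalPhysics.QuantumFieldTheory.Balaban1983to89
open Literature.MathematicalPhysics.QuantumFieldTheory.Balaban1983to89.B5Prop11Plancherel (Tor fine unitVec)
open Literature.MathematicalPhysics.QuantumFieldTheory.Balaban1983to89.B5Block118 (tstep bpt)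
open Literature.MathematicalPhysics.QuantumFieldTheory.Balaban1983to89.B5Composition116 (sites J JEquiv JEquiv_apply sum_J sum_T bpt_bpt_tstep)

variable {d : ℕ} (n L : ℕ) (M : Fin d → ℕ) [hM : ∀ μ, NeZero (M μ)]
variable {E : Type*} [NormedAddCommGroup E] [NormedSpace ℂ E]

/-! ## §1 The composite LINE-indexed transports -/

/-- **the COMPOSITE line transports** `(T ⊛ T′)(y, J, U, μ) := T(y, j₂, t₂, μ) ∘ T′(n·y + j₂ + t₂e_μ, j₁, t₁, μ)` where `J = j₁ + L·j₂` (`JEquiv`) splits the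
long offset into the outer offset `j₂ ∈ [0,n)^d` and the inner offset `j₁ ∈ [0,L)^d`, and `U = t₁ + L·t₂` (`finProdFinEquiv`) splits the position on the long line
(`n·L` steps) into the outer position `t₂ < n` and the inner position `t₁ < L`: the bond at position `U` of the long line started at `(n·L)·y + J` sits at position
`t₁` of the INNER line started at the fine base point `j₁` of the `n`-lattice site `n·y + j₂ + t₂e_μ`, which is position `t₂` of the OUTER line started at `n·y + j₂`
([Balaban1985BackgroundPropagators] (3.15) «compositions of one-step averaging operators», SHAPE; transports DATA). [folklore] -/
def compL (T : Tor M → (Fin d → Fin n) → Fin n → Fin d → (E →L[ℂ] E))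
    (T' : Tor (fine n M) → (Fin d → Fin L) → Fin L → Fin d → (E →L[ℂ] E))
    (y : Tor M) (Jx : Fin d → Fin (n * L)) (U : Fin (n * L)) (μ : Fin d) : E →L[ℂ] E :=
  T y ((JEquiv n L).symm Jx).1 (finProdFinEquiv.symm U).1 μ *
    T' (bpt n M y ((JEquiv n L).symm Jx).1 + tstep (fine n M) μ ((finProdFinEquiv.symm U).1 : ℕ)) ((JEquiv n L).symm Jx).2 (finProdFinEquiv.symm U).2 μ

omit hM in
/-- the composite at split indices: `(T ⊛ T′)(y, J(j₂,j₁), ⟨t₁ + L t₂⟩, μ) = T(y,j₂,t₂,μ) ∘ T′(n·y + j₂ + t₂e_μ, j₁, t₁, μ)`. [folklore] -/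
theorem compL_J (T : Tor M → (Fin d → Fin n) → Fin n → Fin d → (E →L[ℂ] E))
    (T' : Tor (fine n M) → (Fin d → Fin L) → Fin L → Fin d → (E →L[ℂ] E))
    (y : Tor M) (j₂ : Fin d → Fin n) (j₁ : Fin d → Fin L) (t₂ : Fin n) (t₁ : Fin L) (μ : Fin d) :
    compL n L M T T' y (J n L j₂ j₁) (finProdFinEquiv (t₂, t₁)) μ
      = T y j₂ t₂ μ * T' (bpt n M y j₂ + tstep (fine n M) μ t₂) j₁ t₁ μ := by
  have hJ : (JEquiv n L).symm (J n L j₂ j₁) = (j₂, j₁) := (Equiv.symm_apply_eq _).2 (JEquiv_apply n L (j₂, j₁)).symm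
  simp only [compL, hJ, Equiv.symm_apply_apply]

omit hM in
/-- contractive factors give a contractive composite. [folklore] -/
theorem norm_compL_le {T : Tor M → (Fin d → Fin n) → Fin n → Fin d → (E →L[ℂ] E)}
    {T' : Tor (fine n M) → (Fin d → Fin L) → Fin L → Fin d → (E →L[ℂ] E)} (hT : ∀ y j t μ, ‖T y j t μ‖ ≤ 1) (hT' : ∀ x j t μ, ‖T' x j t μ‖ ≤ 1)
    (y : Tor M) (Jx : Fin d → Fin (n * L)) (U : Fin (n * L)) (μ : Fin d) : ‖compL n L M T T' y Jx U μ‖ ≤ 1 := by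
  unfold compL
  refine (norm_mul_le _ _).trans ?_
  have h1 := hT y ((JEquiv n L).symm Jx).1 (finProdFinEquiv.symm U).1 μ
  have h2 := hT' (bpt n M y ((JEquiv n L).symm Jx).1 + tstep (fine n M) μ ((finProdFinEquiv.symm U).1 : ℕ)) ((JEquiv n L).symm Jx).2 (finProdFinEquiv.symm U).2 μ
  nlinarith [norm_nonneg (T y ((JEquiv n L).symm Jx).1 (finProdFinEquiv.symm U).1 μ)]

/-! ## §2 COMPOSITION CLOSES: `Q_{T} ∘ Q_{T′} = Q_{T ⊛ T′}` through the block nesting `sites` -/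

/-- the position split: `(finProdFinEquiv (t₂, t₁) : ℕ) = t₁ + L·t₂`. [folklore] -/
theorem val_finProdFinEquiv (t₂ : Fin n) (t₁ : Fin L) : ((finProdFinEquiv (t₂, t₁) : Fin (n * L)) : ℕ) = (t₁ : ℕ) + L * (t₂ : ℕ) := by
  simp [finProdFinEquiv]

/-- **V-COMP-L: COMPOSITION CLOSES IN THE LINE-INDEXED CLASS** — averaging the one-step (`L`) line-indexed averages over the `n`-blocks with line-indexed
transports IS the `n·L` line-indexed average with the COMPOSITE transports, read through the block nesting `sites : Tor (fine (n·L) M) ≃ Tor (fine L (fine n M))`: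
`Q_T (Q_{T′} W′) = Q_{T ⊛ T′} (W′ ∘ sites)`.  (The tree's (1.16)–(1.18) certificate `sum_J`∕`sum_T`∕`bpt_bpt_tstep`, transports inserted; the BOND-indexed class
is NOT closed under this composition — located note N-ne2leaf03g4-1 (iii).) [folklore] -/
theorem QvL_comp (T : Tor M → (Fin d → Fin n) → Fin n → Fin d → (E →L[ℂ] E))
    (T' : Tor (fine n M) → (Fin d → Fin L) → Fin L → Fin d → (E →L[ℂ] E)) (W' : Tor (fine L (fine n M)) → Fin d → E) :
    QvL n M T (QvL L (fine n M) T' W') = QvL (n * L) M (compL n L M T T') (fun x μ => W' (sites n L M x) μ) := by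
  funext y μ
  unfold QvL
  -- RHS: split the long offset and the long position
  rw [← sum_J n L (fun Jx => ∑ U : Fin (n * L), compL n L M T T' y Jx U μ (W' (sites n L M (bpt (n * L) M y Jx + tstep (fine (n * L) M) μ U)) μ))]
  have hU : ∀ (j₂ : Fin d → Fin n) (j₁ : Fin d → Fin L),
      ∑ U : Fin (n * L), compL n L M T T' y (J n L j₂ j₁) U μ (W' (sites n L M (bpt (n * L) M y (J n L j₂ j₁) + tstep (fine (n * L) M) μ U)) μ)
        = ∑ t₂ : Fin n, ∑ t₁ : Fin L, T y j₂ t₂ μ (T' (bpt n M y j₂ + tstep (fine n M) μ t₂) j₁ t₁ μ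
            (W' (bpt L (fine n M) (bpt n M y j₂ + tstep (fine n M) μ t₂) j₁ + tstep (fine L (fine n M)) μ t₁) μ)) := by
    intro j₂ j₁
    rw [← Equiv.sum_comp finProdFinEquiv, Fintype.sum_prod_type]
    refine Fintype.sum_congr _ _ fun t₂ => Fintype.sum_congr _ _ fun t₁ => ?_
    rw [compL_J, mul_apply_eq_comp, val_finProdFinEquiv, ← bpt_bpt_tstep]
  simp_rw [hU]
  -- LHS: push the outer transport through the inner normalised sum
  simp only [map_smul, map_sum, Finset.smul_sum, smul_smul]
  have hscal : (((n : ℂ) ^ (d + 1))⁻¹ * (((L : ℂ) ^ (d + 1))⁻¹)) = ((((n * L : ℕ) : ℂ) ^ (d + 1))⁻¹) := by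
    push_cast; rw [mul_pow, mul_inv]
  simp_rw [hscal]
  refine Fintype.sum_congr _ _ fun j₂ => ?_
  rw [Finset.sum_comm]

end Summit.QuantumFields.BalabanUV.T4Continuum.VectorBlockTrialForm

end
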